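import Literature.Computability.Cryptography.LWERegevMachineQuery
import Literature.Computability.Complexity.ZerosPrefixBricks
import HarnessLib

/-!
# The average-case-to-worst-case bridge for search-LWE, I: the query generator of one attempt

Topic `Computability/Cryptography` (LWE), grouping namespace `LWE.AmpBricks`. First machine file of
the discharge of hypothesis `h₁` of
`Literature.Computability.Cryptography.regev_lwe_to_sivp_quantum_of_worstCase`
(`RegevDGSReductionWorstCase.lean`): from ONE poly-time uniform quantum family solving
search-`LWE_{q,Ψ̄_α}` on `m` samples with AVERAGE-case success `≥ 2/3`, a family solving it for EVERY
secret with probability exponentially close to `1` (Regev 2009, §2 p. 12 "an algorithm solves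
`LWE_{p,χ}`"; tools: the shift `(a, b) ↦ (a, b + ⟨a, t⟩)` of the proof of Lemma 4.1, which maps
`A_{s,χ}` to `A_{s+t,χ}` with `s + t` uniform, and repetition with a majority vote).

The amplified family runs `K₀(n) = 18(n+1)` ATTEMPTS in parallel (the indexed copies of
`QuantumComplexity/PolyCopiesIdx.lean`, copy `j` receiving `u ++ eⱼ`, `u = ⟨x, ε⟩`,
`x = encodeLWESamples S` the worst-case input of `m' = K₀ m` samples, `eⱼ` one-hot); attempt `j`
draws its own coins `c` (the Hadamard coins of `QuantumComplexity/CoinPrefix.lean`, appended raw: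
the classical pre-processor sees `z = ⟨x, eⱼ ++ c⟩`), shifts BATCH `j` of the samples (samples
`m j, …, m j + m − 1`) by the vector `t ∈ ℤ_qⁿ` read off `c` chunk by chunk (`CoinChunks.chunkVal`,
width `n + |bin q|`, so that `t` is `n q 2^{-(n+|bin q|)} ≤ n 2^{-n}`-close to uniform), and feeds the
code of the shifted batch to the given solver. This file is that pre-processor, as ONE total string
function `queryZ` in the tree's algebra of `FP` string functions, written exactly like the query
generator `RegevBricks.queryQ` of the decision-to-search machine (`LWERegevMachineQuery.lean`: same
contexts `v = ⟨z, 1^{idx}⟩`, `u = ⟨v, 1^{i'}⟩`, same sample readers and folds), with its value: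

* accessors and parameters of the root `z = ⟨x, eⱼ ++ c⟩`: `xZ`, `ecZ`, `bnZ`, `bqZ`, `umZ`, `blkZ`;
  the attempt number `jU = 1ʲ` (`zerosPrefixFn`, `ZerosPrefixBricks.lean`), `bjZ = bin j`; the coins
  `cZ = c` (drop the `2|x| + 3` bits of `eⱼ`); `bK0Z = bin K₀(n)`, `bmZ = bin m` (`m = m'/K₀`), the
  rulers `onesNZ = 1ⁿ`, `onesMZ = 1ᵐ`, `rulerZ = 1^{n + |bin q|}`;
* the shift coordinate `tvalU = bin tᵢ'` (`chunkF`, `remFn`), the input sample of a slot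
  `sampleV` (sample `idx + m j`), `bvalV`, `aframesV`, `avalU`, the inner product `ipSumV`, the new
  second entry `bOutV = bin (b + ⟨a, t⟩)`, the transformed sample `sampleOutV`, the block `qBlockZ`
  and **`queryZ`** `= ⟨bin n, ⟨bin q, ⟨1ᵐ, block⟩⟩⟩`, all in `FP`;
* the specification side: `K0`, `Kw`, `oneHot`, `zOf`, `shiftOfCoins`, `batchOf` (= `blocksOf`),
  `queryOf`, and **`queryZ_zOf`**: on `zOf S j c` (`j < K₀(n)`, `0 < n`, `0 < m`, coins of length
  `≥ n |bin q|`) the generator returns `encodeLWESamples (queryOf S j c)`, the code of batch `j`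
  shifted by `shiftOfCoins n q c`.

## References

* O. Regev, *On lattices, learning with errors, random linear codes, and cryptography*, J. ACM 56
  (2009), art. 34, §2 (p. 12) and §4, proof of Lemma 4.1 (held: arXiv:2401.03703, p. 23).
  [cite: Regev2009, §4 Lemma 4.1 (proof)]
* S. Arora, B. Barak, *Computational Complexity: A Modern Approach*, CUP 2009, §1.3, §7.4.1.
  [cite: AroraBarak2009, §1.3]
-/

noncomputable section

namespace Literature.Computability.Cryptography

namespace LWE

namespace AmpBricks

open _root_.Computability Polynomial Literature.Computability.Complexity Brick Plumb HashBricks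
open RegevBricks (rootV slotV rootU ipU rootV_mem_FP idxV_mem_FP rootU_mem_FP ipU_mem_FP loopRec loopRec_mem_FP
  loopRec_apply length_encodeNat_le_of_lt frames_ofFn_eq_ccat')

set_option synthInstance.maxSize 512

/-! ### Specification side -/

section Spec

variable {n q m : ℕ}

/-- **The number of attempts (batches)**: `K₀(n) = 18 (n + 1)`. [cite: AroraBarak2009, §7.4.1 (error reduction: O(n) repetitions)] -/
def K0 (n : ℕ) : ℕ := 18 * (n + 1)

/-- `K₀(n) > 0`. [folklore] -/
theorem K0_pos (n : ℕ) : 0 < K0 n := by unfold K0; omega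

/-- **The chunk width** for reading a coordinate of the shift off the coins: `n + |bin q|`. [folklore] -/
def Kw (n q : ℕ) : ℕ := n + (encodeNat q).length

/-- The one-hot word of attempt `j` among `Kc` (position `j` is `1`). [folklore] -/
def oneHot (Kc j : ℕ) : List Bool := List.replicate j false ++ true :: List.replicate (Kc - j - 1) false

/-- Length of a one-hot word. [folklore] -/
theorem length_oneHot {Kc j : ℕ} (h : j < Kc) : (oneHot Kc j).length = Kc := by
  simp [oneHot]; omega

/-- The length of the one-hot word fed to the attempts: `2|x| + 3` (`|⟨x, ε⟩| + 1` copies). [folklore] -/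
def Kc (x : List Bool) : ℕ := 2 * x.length + 3

/-- **The root input of the pre-processor of attempt `j`**: `z = ⟨x, eⱼ ++ c⟩`,
`x = encodeLWESamples S`. [folklore] -/
def zOf (S : Fin (K0 n * m) → (Fin n → ZMod q) × ZMod q) (j : ℕ) (c : List Bool) : List Bool :=
  boolPair (encodeLWESamples S) (oneHot (Kc (encodeLWESamples S)) j ++ c)

/-- **The shift read off the coins**: coordinate `i` is chunk `i` of width `Kw n q`, as a binary
number mod `q` (`CoinChunks.chunkVal`). [cite: Regev2009, §4 Lemma 4.1 (proof: "t ∈ ℤ_pⁿ chosen uniformly")] -/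
def shiftOfCoins (n q : ℕ) (c : List Bool) : Fin n → ZMod q := fun i => chunkVal (Kw n q) q c i

/-- **Batch `j`** of the `K₀ m` samples: samples `m j, …, m j + m − 1` (`= blocksOf (K0 n) m S j`).
[cite: Regev2009, §2 (m independent samples)] -/
def batchOf (S : Fin (K0 n * m) → (Fin n → ZMod q) × ZMod q) (j : Fin (K0 n)) : Fin m → (Fin n → ZMod q) × ZMod q :=
  fun idx => S (finProdFinEquiv (j, idx))

/-- **The query of attempt `j`**: batch `j`, every sample shifted by `t = shiftOfCoins n q c`
(Regev's `f_t`). [cite: Regev2009, §4 Lemma 4.1 (proof)] -/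
def queryOf (S : Fin (K0 n * m) → (Fin n → ZMod q) × ZMod q) (j : Fin (K0 n)) (c : List Bool) :
    Fin m → (Fin n → ZMod q) × ZMod q :=
  fun idx => shiftSample (shiftOfCoins n q c) (batchOf S j idx)

/-- The flat number of the input sample of slot `idx` of batch `j`: `idx + m j`. [folklore] -/
theorem val_finProdFinEquiv_batch (j : Fin (K0 n)) (idx : Fin m) :
    (finProdFinEquiv (j, idx) : Fin (K0 n * m)).val = idx + m * j := finProdFinEquiv_apply_val _

end Spec

/-! ### The bricks -/

section Defs

/-- The sample code `x` of `z = ⟨x, eⱼ ++ c⟩`. [folklore] -/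
def xZ : List Bool → List Bool := fstF
/-- The tail `eⱼ ++ c`. [folklore] -/
def ecZ : List Bool → List Bool := sndF
/-- `bin n`. [folklore] -/
def bnZ : List Bool → List Bool := nthF 0 ∘ xZ
/-- `bin q`. [folklore] -/
def bqZ : List Bool → List Bool := nthF 1 ∘ xZ
/-- `1^{m'}`. [folklore] -/
def umZ : List Bool → List Bool := nthF 2 ∘ xZ
/-- The framed sample codes. [folklore] -/
def blkZ : List Bool → List Bool := sndPow 2 ∘ xZ
/-- **The attempt number in unary**, `1ʲ`, read off the one-hot word. [folklore] -/
def jU : List Bool → List Bool := zerosPrefixFn ∘ ecZ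
/-- `bin j`. [folklore] -/
def bjZ : List Bool → List Bool := lenBinF ∘ jU
/-- **The coins** `c`: drop the `2|x| + 3` bits of the one-hot word. [folklore] -/
def cZ : List Bool → List Bool := dropFn ∘ fanoutFn (polyFn (2 * X + 3) ∘ xZ) ecZ
/-- `bin K₀(n) = bin (18 (n + 1))`. [folklore] -/
def bK0Z : List Bool → List Bool :=
  prodFn ∘ fanoutFn (fun _ => encodeNat 18) (addFn ∘ fanoutFn bnZ (fun _ => encodeNat 1))
/-- `bin m`, `m = m' / K₀(n)`. [folklore] -/
def bmZ : List Bool → List Bool := divFn ∘ fanoutFn (lenBinF ∘ umZ) bK0Z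
/-- `1ⁿ` (capped binary-to-unary). [folklore] -/
def onesNZ : List Bool → List Bool := binToUnaryFn ∘ fanoutFn (fun z => z) bnZ
/-- `1ᵐ` (capped binary-to-unary). [folklore] -/
def onesMZ : List Bool → List Bool := binToUnaryFn ∘ fanoutFn (fun z => z) bmZ
/-- The chunk-width ruler `1^{n + |bin q|}`. [folklore] -/
def rulerZ : List Bool → List Bool := fun z => onesNZ z ++ onesFn (bqZ z)

/-- **`bin tᵢ'`**: chunk `i'` of the coins, reduced mod `q` (context `u = ⟨⟨z, 1^{idx}⟩, 1^{i'}⟩`).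
[cite: Regev2009, §4 Lemma 4.1 (proof)] -/
def tvalU : List Bool → List Bool :=
  remFn ∘ fanoutFn
    (chunkF ∘ fanoutFn rootU (fanoutFn (rulerZ ∘ rootU) (fanoutFn (lenBinF ∘ ipU) (cZ ∘ rootU))))
    (bqZ ∘ rootU)

/-- `bin (idx + m j)`: the number of the input sample of slot `idx` of attempt `j`. [folklore] -/
def bSlotV : List Bool → List Bool :=
  addFn ∘ fanoutFn (lenBinF ∘ slotV) (prodFn ∘ fanoutFn (bmZ ∘ rootV) (bjZ ∘ rootV))

/-- The code `⟨⟨1ⁿ, frames of a⟩, bin b⟩` of the input sample of the slot. [folklore] -/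
def sampleV : List Bool → List Bool := nthLF ∘ fanoutFn rootV (fanoutFn bSlotV (blkZ ∘ rootV))

/-- `bin b` of the input sample. [folklore] -/
def bvalV : List Bool → List Bool := sndF ∘ sampleV

/-- The framed residues of `a` of the input sample. [folklore] -/
def aframesV : List Bool → List Bool := sndF ∘ fstF ∘ sampleV

/-- `bin aᵢ'` of the input sample (depth-two context). [folklore] -/
def avalU : List Bool → List Bool := nthLF ∘ fanoutFn rootU (fanoutFn (lenBinF ∘ ipU) (aframesV ∘ fstF))

/-- The product `bin (aᵢ' · tᵢ')` (piece of the inner-product fold). [folklore] -/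
def ipP : List Bool → List Bool := prodFn ∘ fanoutFn avalU tvalU

/-- **`⟨a, t⟩` as a natural** (before reduction): an `addFn`-fold over `i' < n`. [cite: Regev2009, §4 Lemma 4.1 (proof: f_t)] -/
def ipSumV : List Bool → List Bool := sndPow 2 ∘ foldLoop addFn (clipF 2 ipP) X ∘ loopRec (bnZ ∘ rootV)

/-- **`bin b''`**, `b'' = (b + ⟨a, t⟩) mod q`. [cite: Regev2009, §4 Lemma 4.1 (proof: f_t)] -/
def bOutV : List Bool → List Bool := remFn ∘ fanoutFn (addFn ∘ fanoutFn bvalV ipSumV) (bqZ ∘ rootV)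

/-- The code `⟨⟨1ⁿ, frames of a⟩, bin b''⟩` of the transformed sample (the first field of the input
sample code is reused verbatim: `a` is unchanged). [cite: Regev2009, §4 Lemma 4.1 (proof)] -/
def sampleOutV : List Bool → List Bool := fanoutFn (fstF ∘ sampleV) bOutV

/-- The one-item frame of the transformed sample (piece of the block fold). [folklore] -/
def sampleFrameP : List Bool → List Bool := fanoutFn sampleOutV (fun _ => [])

/-- **The framed block**: an `appF`-fold over the slots `idx < m`. [cite: Regev2009, §4 Lemma 4.1 (proof)] -/
def qBlockZ : List Bool → List Bool := sndPow 2 ∘ foldLoop appF (clipF 64 sampleFrameP) X ∘ loopRec bmZ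

/-- **The query generator**: `⟨bin n, ⟨bin q, ⟨1ᵐ, block⟩⟩⟩`, the code of the shifted batch.
[cite: Regev2009, §4 Lemma 4.1 (proof)] -/
def queryZ : List Bool → List Bool := fanoutFn bnZ (fanoutFn bqZ (fanoutFn onesMZ qBlockZ))

end Defs

/-! ### Polynomial time -/

section FP

/-- `xZ ∈ FP`. [folklore] -/
theorem xZ_mem_FP : xZ ∈ FP := fstF_mem_FP
/-- `ecZ ∈ FP`. [folklore] -/
theorem ecZ_mem_FP : ecZ ∈ FP := sndF_mem_FP
/-- `bnZ ∈ FP`. [folklore] -/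
theorem bnZ_mem_FP : bnZ ∈ FP := comp_mem_FP (nthF_mem_FP 0) xZ_mem_FP
/-- `bqZ ∈ FP`. [folklore] -/
theorem bqZ_mem_FP : bqZ ∈ FP := comp_mem_FP (nthF_mem_FP 1) xZ_mem_FP
/-- `umZ ∈ FP`. [folklore] -/
theorem umZ_mem_FP : umZ ∈ FP := comp_mem_FP (nthF_mem_FP 2) xZ_mem_FP
/-- `blkZ ∈ FP`. [folklore] -/
theorem blkZ_mem_FP : blkZ ∈ FP := comp_mem_FP (sndPow_mem_FP 2) xZ_mem_FP
/-- `jU ∈ FP`. [folklore] -/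
theorem jU_mem_FP : jU ∈ FP := comp_mem_FP zerosPrefixFn_mem_FP ecZ_mem_FP
/-- `bjZ ∈ FP`. [folklore] -/
theorem bjZ_mem_FP : bjZ ∈ FP := comp_mem_FP lenBinF_mem_FP jU_mem_FP
/-- `cZ ∈ FP`. [folklore] -/
theorem cZ_mem_FP : cZ ∈ FP :=
  comp_mem_FP dropFn_mem_FP (fanoutFn_mem_FP (comp_mem_FP (polyFn_mem_FP _) xZ_mem_FP) ecZ_mem_FP)
/-- `bK0Z ∈ FP`. [folklore] -/
theorem bK0Z_mem_FP : bK0Z ∈ FP :=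
  comp_mem_FP prodFn_mem_FP (fanoutFn_mem_FP (const_mem_FP _)
    (comp_mem_FP addFn_mem_FP (fanoutFn_mem_FP bnZ_mem_FP (const_mem_FP _))))
/-- `bmZ ∈ FP`. [folklore] -/
theorem bmZ_mem_FP : bmZ ∈ FP :=
  comp_mem_FP divFn_mem_FP (fanoutFn_mem_FP (comp_mem_FP lenBinF_mem_FP umZ_mem_FP) bK0Z_mem_FP)
/-- `onesNZ ∈ FP`. [folklore] -/
theorem onesNZ_mem_FP : onesNZ ∈ FP :=
  comp_mem_FP binToUnaryFn_mem_FP (fanoutFn_mem_FP OracleCompose.id_mem_FP bnZ_mem_FP)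
/-- `onesMZ ∈ FP`. [folklore] -/
theorem onesMZ_mem_FP : onesMZ ∈ FP :=
  comp_mem_FP binToUnaryFn_mem_FP (fanoutFn_mem_FP OracleCompose.id_mem_FP bmZ_mem_FP)
/-- `rulerZ ∈ FP`. [folklore] -/
theorem rulerZ_mem_FP : rulerZ ∈ FP := append_mem_FP onesNZ_mem_FP (comp_mem_FP onesFn_mem_FP bqZ_mem_FP)
/-- `tvalU ∈ FP`. [folklore] -/
theorem tvalU_mem_FP : tvalU ∈ FP :=
  comp_mem_FP remFn_mem_FP (fanoutFn_mem_FP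
    (comp_mem_FP chunkF_mem_FP (fanoutFn_mem_FP rootU_mem_FP (fanoutFn_mem_FP (comp_mem_FP rulerZ_mem_FP rootU_mem_FP)
      (fanoutFn_mem_FP (comp_mem_FP lenBinF_mem_FP ipU_mem_FP) (comp_mem_FP cZ_mem_FP rootU_mem_FP)))))
    (comp_mem_FP bqZ_mem_FP rootU_mem_FP))
/-- `bSlotV ∈ FP`. [folklore] -/
theorem bSlotV_mem_FP : bSlotV ∈ FP :=
  comp_mem_FP addFn_mem_FP (fanoutFn_mem_FP (comp_mem_FP lenBinF_mem_FP idxV_mem_FP)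
    (comp_mem_FP prodFn_mem_FP (fanoutFn_mem_FP (comp_mem_FP bmZ_mem_FP rootV_mem_FP)
      (comp_mem_FP bjZ_mem_FP rootV_mem_FP))))
/-- `sampleV ∈ FP`. [folklore] -/
theorem sampleV_mem_FP : sampleV ∈ FP :=
  comp_mem_FP nthLF_mem_FP (fanoutFn_mem_FP rootV_mem_FP (fanoutFn_mem_FP bSlotV_mem_FP
    (comp_mem_FP blkZ_mem_FP rootV_mem_FP)))
/-- `bvalV ∈ FP`. [folklore] -/
theorem bvalV_mem_FP : bvalV ∈ FP := comp_mem_FP sndF_mem_FP sampleV_mem_FP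
/-- `aframesV ∈ FP`. [folklore] -/
theorem aframesV_mem_FP : aframesV ∈ FP := comp_mem_FP sndF_mem_FP (comp_mem_FP fstF_mem_FP sampleV_mem_FP)
/-- `avalU ∈ FP`. [folklore] -/
theorem avalU_mem_FP : avalU ∈ FP :=
  comp_mem_FP nthLF_mem_FP (fanoutFn_mem_FP rootU_mem_FP (fanoutFn_mem_FP (comp_mem_FP lenBinF_mem_FP ipU_mem_FP)
    (comp_mem_FP aframesV_mem_FP fstF_mem_FP)))
/-- `ipP ∈ FP`. [folklore] -/
theorem ipP_mem_FP : ipP ∈ FP := comp_mem_FP prodFn_mem_FP (fanoutFn_mem_FP avalU_mem_FP tvalU_mem_FP)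
/-- `ipSumV ∈ FP`. [folklore] -/
theorem ipSumV_mem_FP : ipSumV ∈ FP :=
  comp_mem_FP (sndPow_mem_FP 2) (comp_mem_FP (foldLoop_clipF_mem_FP 2 addFn_mem_FP length_addFn_le ipP_mem_FP X)
    (loopRec_mem_FP (comp_mem_FP bnZ_mem_FP rootV_mem_FP)))
/-- `bOutV ∈ FP`. [folklore] -/
theorem bOutV_mem_FP : bOutV ∈ FP :=
  comp_mem_FP remFn_mem_FP (fanoutFn_mem_FP (comp_mem_FP addFn_mem_FP (fanoutFn_mem_FP bvalV_mem_FP ipSumV_mem_FP))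
    (comp_mem_FP bqZ_mem_FP rootV_mem_FP))
/-- `sampleOutV ∈ FP`. [folklore] -/
theorem sampleOutV_mem_FP : sampleOutV ∈ FP :=
  fanoutFn_mem_FP (comp_mem_FP fstF_mem_FP sampleV_mem_FP) bOutV_mem_FP
/-- `sampleFrameP ∈ FP`. [folklore] -/
theorem sampleFrameP_mem_FP : sampleFrameP ∈ FP := fanoutFn_mem_FP sampleOutV_mem_FP (const_mem_FP _)
/-- `qBlockZ ∈ FP`. [folklore] -/
theorem qBlockZ_mem_FP : qBlockZ ∈ FP :=
  comp_mem_FP (sndPow_mem_FP 2) (comp_mem_FP (foldLoop_clipF_mem_FP 64 appF_mem_FP length_appF_le sampleFrameP_mem_FP X)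
    (loopRec_mem_FP bmZ_mem_FP))
/-- **`queryZ ∈ FP`.** [cite: AroraBarak2009, §1.3] -/
theorem queryZ_mem_FP : queryZ ∈ FP :=
  fanoutFn_mem_FP bnZ_mem_FP (fanoutFn_mem_FP bqZ_mem_FP (fanoutFn_mem_FP onesMZ_mem_FP qBlockZ_mem_FP))

end FP

/-! ### Values on the root input of an attempt -/

section Values

variable {n q m : ℕ} (S : Fin (K0 n * m) → (Fin n → ZMod q) × ZMod q) (j : ℕ) (c : List Bool)

/-- `zOf` unfolded. [folklore] -/
theorem zOf_eq : zOf S j c = boolPair (encodeLWESamples S) (oneHot (Kc (encodeLWESamples S)) j ++ c) := rfl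

/-- Value of `xZ`. [folklore] -/
@[simp] theorem xZ_zOf : xZ (zOf S j c) = encodeLWESamples S := fstF_boolPair _ _
/-- Value of `ecZ`. [folklore] -/
@[simp] theorem ecZ_zOf : ecZ (zOf S j c) = oneHot (Kc (encodeLWESamples S)) j ++ c := sndF_boolPair _ _
/-- Value of `bnZ`. [folklore] -/
@[simp] theorem bnZ_zOf : bnZ (zOf S j c) = encodeNat n := by
  simp [bnZ, xZ, zOf, encodeLWESamples_eq]
/-- Value of `bqZ`. [folklore] -/
@[simp] theorem bqZ_zOf : bqZ (zOf S j c) = encodeNat q := by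
  simp [bqZ, xZ, zOf, encodeLWESamples_eq]
/-- Value of `umZ`. [folklore] -/
@[simp] theorem umZ_zOf : umZ (zOf S j c) = ones (K0 n * m) := by
  simp [umZ, xZ, zOf, encodeLWESamples_eq]
/-- Value of `blkZ`. [folklore] -/
@[simp] theorem blkZ_zOf : blkZ (zOf S j c) = lweBlockCode S := by
  simp [blkZ, xZ, zOf, encodeLWESamples_eq]

/-- **Value of `jU`**: the attempt number `1ʲ` (`j < Kc`). [folklore] -/
theorem jU_zOf : jU (zOf S j c) = ones j := by
  rw [jU, Function.comp_apply, ecZ_zOf, oneHot, List.append_assoc, List.cons_append, zerosPrefixFn_replicate_append]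

/-- Value of `bjZ`: `bin j`. [folklore] -/
theorem bjZ_zOf : bjZ (zOf S j c) = encodeNat j := by
  rw [bjZ, Function.comp_apply, jU_zOf S j c, lenBinF_apply]
  simp [ones]

/-- **Value of `cZ`**: the coins. [folklore] -/
theorem cZ_zOf (hj : j < Kc (encodeLWESamples S)) : cZ (zOf S j c) = c := by
  have hl : (polyFn (2 * X + 3) (encodeLWESamples S)).length = (oneHot (Kc (encodeLWESamples S)) j).length := by
    rw [polyFn_apply, length_oneHot hj]; simp [ones, Kc]
  rw [cZ, Function.comp_apply, fanoutFn_apply, Function.comp_apply, xZ_zOf, ecZ_zOf, dropFn_boolPair]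
  exact List.drop_left' hl.symm

/-- Value of `bK0Z`: `bin K₀(n)`. [folklore] -/
@[simp] theorem bK0Z_zOf : bK0Z (zOf S j c) = encodeNat (K0 n) := by
  simp [bK0Z, K0]

/-- **Value of `bmZ`**: `bin m`. [folklore] -/
@[simp] theorem bmZ_zOf : bmZ (zOf S j c) = encodeNat m := by
  simp only [bmZ, Function.comp_apply, fanoutFn_apply, lenBinF_apply, umZ_zOf, bK0Z_zOf, divFn_boolPair, bitsToNat_encodeNat,
    ones, List.length_replicate]
  exact congrArg encodeNat (Nat.mul_div_cancel_left m (K0_pos n))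

/-- **Length bounds of the root** (`0 < m`): `n`, `|bin q|`, `K₀ m`, `m`, `|x|` are all `≤ |z|`. [folklore] -/
theorem bounds_zOf (hm : 0 < m) :
    n ≤ (zOf S j c).length ∧ (encodeNat q).length ≤ (zOf S j c).length ∧ K0 n * m ≤ (zOf S j c).length ∧
      m ≤ (zOf S j c).length ∧ (encodeLWESamples S).length ≤ (zOf S j c).length ∧ c.length ≤ (zOf S j c).length := by
  obtain ⟨h1, h2, h3⟩ := le_length_encodeLWESamples (Nat.mul_pos (K0_pos n) hm) S
  have h4 : m ≤ K0 n * m := Nat.le_mul_of_pos_left m (K0_pos n)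
  rw [zOf_eq, length_boolPair, List.length_append]
  omega

/-- Value of `onesNZ`: `1ⁿ`. [folklore] -/
theorem onesNZ_zOf (hm : 0 < m) : onesNZ (zOf S j c) = ones n := by
  obtain ⟨hn, -⟩ := bounds_zOf S j c hm
  simp only [onesNZ, Function.comp_apply, fanoutFn_apply, bnZ_zOf, binToUnaryFn_boolPair, bitsToNat_encodeNat, min_eq_left hn]

/-- Value of `onesMZ`: `1ᵐ`. [folklore] -/
theorem onesMZ_zOf (hm : 0 < m) : onesMZ (zOf S j c) = ones m := by
  obtain ⟨-, -, -, hmz, -⟩ := bounds_zOf S j c hm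
  simp only [onesMZ, Function.comp_apply, fanoutFn_apply, bmZ_zOf, binToUnaryFn_boolPair, bitsToNat_encodeNat,
    min_eq_left hmz]

/-- **Value of `rulerZ`**: `1^{Kw n q}`. [folklore] -/
theorem rulerZ_zOf (hm : 0 < m) : rulerZ (zOf S j c) = ones (Kw n q) := by
  rw [rulerZ, onesNZ_zOf S j c hm, bqZ_zOf, onesFn, Complexity.unaryEncodeNat_eq_replicate, Kw]
  exact (List.replicate_add _ _ _).symm

/-! #### Contexts -/

/-- The depth-one context of slot `idx`. [folklore] -/
def vOf (idx : ℕ) : List Bool := boolPair (zOf S j c) (ones idx)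
/-- The depth-two context of slot `idx`, coordinate `i'`. [folklore] -/
def uOf (idx i' : ℕ) : List Bool := boolPair (vOf S j c idx) (ones i')

variable (idx i' : ℕ)

/-- Root of `vOf`. [folklore] -/
@[simp] theorem fstF_vOf : fstF (vOf S j c idx) = zOf S j c := fstF_boolPair _ _
/-- Index of `vOf`. [folklore] -/
@[simp] theorem sndF_vOf : sndF (vOf S j c idx) = ones idx := sndF_boolPair _ _
/-- First field of `uOf`. [folklore] -/
@[simp] theorem fstF_uOf : fstF (uOf S j c idx i') = vOf S j c idx := fstF_boolPair _ _
/-- Index of `uOf`. [folklore] -/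
@[simp] theorem sndF_uOf : sndF (uOf S j c idx i') = ones i' := sndF_boolPair _ _
/-- `vOf` unfolded. [folklore] -/
theorem vOf_eq : vOf S j c idx = boolPair (zOf S j c) (ones idx) := rfl
/-- `uOf` unfolded. [folklore] -/
theorem uOf_eq : uOf S j c idx i' = boolPair (vOf S j c idx) (ones i') := rfl

variable {S j c idx i'}

/-- **Value of `tvalU`**: `bin tᵢ'` (`i' < n`). [cite: Regev2009, §4 Lemma 4.1 (proof: the uniform shift t)] -/
theorem tvalU_apply (hm : 0 < m) (hj : j < Kc (encodeLWESamples S)) (hi : i' < n) :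
    tvalU (uOf S j c idx i') = encodeNat (shiftOfCoins n q c ⟨i', hi⟩).val := by
  obtain ⟨hnz, -⟩ := bounds_zOf S j c hm
  have hl : (ones i').length = i' := List.length_replicate
  rw [tvalU]
  simp only [Function.comp_apply, fanoutFn_apply, rootU, ipU, fstF_uOf, sndF_uOf, fstF_vOf]
  rw [rulerZ_zOf S j c hm, cZ_zOf S j c hj, bqZ_zOf, lenBinF_apply, chunkF_apply, bitsToNat_encodeNat, hl,
    min_eq_left (hi.le.trans hnz), remFn_boolPair, bitsToNat_encodeNat, shiftOfCoins]
  rw [chunkVal, ZMod.val_natCast, chunk]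

/-- The flat number of the slot is below the number of samples (`j < K₀`, `idx < m`). [folklore] -/
theorem slot_lt (hj : j < K0 n) (hidx : idx < m) : idx + m * j < K0 n * m := by
  have h := (finProdFinEquiv ((⟨j, hj⟩ : Fin (K0 n)), (⟨idx, hidx⟩ : Fin m))).isLt
  rw [finProdFinEquiv_apply_val] at h
  exact h

/-- Value of `bSlotV`: `bin (idx + m j)`. [folklore] -/
theorem bSlotV_apply : bSlotV (vOf S j c idx) = encodeNat (idx + m * j) := by
  simp only [bSlotV, Function.comp_apply, fanoutFn_apply, rootV, slotV, fstF_vOf, sndF_vOf, lenBinF_apply, ones,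
    List.length_replicate, bmZ_zOf, bjZ_zOf S j c, prodFn_boolPair, addFn_boolPair, bitsToNat_encodeNat]

/-- `j < K₀(n)` implies `j < Kc` (there are more copies than attempts, `0 < m`). [folklore] -/
theorem lt_Kc_of_lt_K0 (hm : 0 < m) (hj : j < K0 n) : j < Kc (encodeLWESamples S) := by
  obtain ⟨-, -, h3⟩ := le_length_encodeLWESamples (Nat.mul_pos (K0_pos n) hm) S
  have : K0 n ≤ K0 n * m := Nat.le_mul_of_pos_right _ hm
  unfold Kc; omega

/-- **Value of `sampleV`**: the code of input sample `idx + m j`. [cite: Regev2009, §2] -/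
theorem sampleV_apply (hm : 0 < m) (hj : j < K0 n) (hidx : idx < m) :
    sampleV (vOf S j c idx) = lweSampleCode (batchOf S ⟨j, hj⟩ ⟨idx, hidx⟩) := by
  obtain ⟨-, -, hKm, -⟩ := bounds_zOf S j c hm
  have hslot : idx + m * j < K0 n * m := slot_lt hj hidx
  rw [sampleV, Function.comp_apply, fanoutFn_apply, fanoutFn_apply, bSlotV_apply]
  simp only [rootV, Function.comp_apply, fstF_vOf, blkZ_zOf]
  rw [lweBlockCode_eq, nthLF_apply _ (hslot.le.trans hKm)]
  have e : idx + m * j = ((finProdFinEquiv ((⟨j, hj⟩ : Fin (K0 n)), (⟨idx, hidx⟩ : Fin m)) : Fin (K0 n * m)) : ℕ) := by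
    rw [finProdFinEquiv_apply_val]
  rw [e, getD_sampleList]
  rfl

/-- Value of `bvalV`: `bin b`. [folklore] -/
theorem bvalV_apply (hm : 0 < m) (hj : j < K0 n) (hidx : idx < m) :
    bvalV (vOf S j c idx) = encodeNat ((batchOf S ⟨j, hj⟩ ⟨idx, hidx⟩).2).val := by
  rw [bvalV, Function.comp_apply, sampleV_apply hm hj hidx, sndF_lweSampleCode]

/-- Value of `aframesV`: the residue code of `a`. [folklore] -/
theorem aframesV_apply (hm : 0 < m) (hj : j < K0 n) (hidx : idx < m) :
    aframesV (vOf S j c idx) = lweResidueCode (batchOf S ⟨j, hj⟩ ⟨idx, hidx⟩).1 := by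
  simp only [aframesV, Function.comp_apply, sampleV_apply hm hj hidx, sndF_fstF_lweSampleCode]

/-- The first field of the input sample code: `⟨1ⁿ, residue code of a⟩`. [folklore] -/
theorem fstF_sampleV_apply (hm : 0 < m) (hj : j < K0 n) (hidx : idx < m) :
    fstF (sampleV (vOf S j c idx)) = boolPair (ones n) (lweResidueCode (batchOf S ⟨j, hj⟩ ⟨idx, hidx⟩).1) := by
  rw [sampleV_apply hm hj hidx, lweSampleCode, fstF_boolPair]

/-- **Value of `avalU`**: `bin aᵢ'`. [folklore] -/
theorem avalU_apply (hm : 0 < m) (hj : j < K0 n) (hidx : idx < m) (hi : i' < n) :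
    avalU (uOf S j c idx i') = encodeNat (((batchOf S ⟨j, hj⟩ ⟨idx, hidx⟩).1 ⟨i', hi⟩)).val := by
  obtain ⟨hnz, -⟩ := bounds_zOf S j c hm
  rw [avalU, Function.comp_apply, fanoutFn_apply, fanoutFn_apply]
  simp only [rootU, ipU, Function.comp_apply, fstF_uOf, sndF_uOf, fstF_vOf, lenBinF_apply, ones, List.length_replicate,
    aframesV_apply hm hj hidx, lweResidueCode_eq]
  rw [nthLF_apply _ (hi.le.trans hnz), List.getD_eq_getElem _ _ (by rw [length_residueList]; exact hi), getElem_residueList]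

/-- Value of `ipP` (raw index). [folklore] -/
theorem ipP_apply (hm : 0 < m) (hj : j < K0 n) (hidx : idx < m) (hi : i' < n) :
    ipP (uOf S j c idx i') =
      encodeNat ((((batchOf S ⟨j, hj⟩ ⟨idx, hidx⟩).1 ⟨i', hi⟩)).val * (shiftOfCoins n q c ⟨i', hi⟩).val) := by
  rw [ipP, Function.comp_apply, fanoutFn_apply, avalU_apply hm hj hidx hi, tvalU_apply hm (lt_Kc_of_lt_K0 hm hj) hi,
    prodFn_boolPair, bitsToNat_encodeNat, bitsToNat_encodeNat]

variable [NeZero q]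

/-- **Value of `ipSumV`**: `bin (∑ᵢ aᵢ.val · tᵢ.val)`. [cite: Regev2009, §4 Lemma 4.1 (proof)] -/
theorem ipSumV_apply (hm : 0 < m) (hj : j < K0 n) (hidx : idx < m) :
    ipSumV (vOf S j c idx) =
      encodeNat (∑ i' : Fin n, (((batchOf S ⟨j, hj⟩ ⟨idx, hidx⟩).1 i')).val * (shiftOfCoins n q c i').val) := by
  obtain ⟨hnz, hqz, -⟩ := bounds_zOf S j c hm
  have hnv : n ≤ (X : Polynomial ℕ).eval (vOf S j c idx).length := by
    rw [eval_X, vOf_eq, length_boolPair]; omega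
  rw [ipSumV, Function.comp_apply, Function.comp_apply, loopRec_apply]
  simp only [Function.comp_apply, rootV, fstF_vOf, bnZ_zOf]
  rw [foldLoop_apply _ _ hnv, sndPow_succ_boolPair, sndPow_succ_boolPair, sndPow_zero, sndF_boolPair, foldAcc_clipF]
  · refine (foldAcc_addFn _ _ n 0 0).trans (congrArg encodeNat ?_)
    rw [zero_add, Finset.sum_range]
    refine Finset.sum_congr rfl fun i' _ => ?_
    rw [zero_add, ← uOf_eq, ipP_apply hm hj hidx i'.isLt, bitsToNat_encodeNat]
  · intro i _ hi
    rw [zero_add] at hi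
    rw [← uOf_eq, ipP_apply hm hj hidx hi, vOf_eq, length_boolPair]
    have h1 := length_encodeNat_val_le (((batchOf S ⟨j, hj⟩ ⟨idx, hidx⟩).1 ⟨i, hi⟩))
    have h2 := length_encodeNat_val_le (shiftOfCoins n q c ⟨i, hi⟩)
    have h3 := Complexity.length_encodeNat_mul_le (((batchOf S ⟨j, hj⟩ ⟨idx, hidx⟩).1 ⟨i, hi⟩)).val
      (shiftOfCoins n q c ⟨i, hi⟩).val
    omega

/-- **Value of `bOutV`**: `bin (b + ⟨a, t⟩).val`. [cite: Regev2009, §4 Lemma 4.1 (proof: f_t(a,b) = (a, b + ⟨a,t⟩))] -/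
theorem bOutV_apply (hm : 0 < m) (hj : j < K0 n) (hidx : idx < m) :
    bOutV (vOf S j c idx) =
      encodeNat ((batchOf S ⟨j, hj⟩ ⟨idx, hidx⟩).2 + (batchOf S ⟨j, hj⟩ ⟨idx, hidx⟩).1 ⬝ᵥ shiftOfCoins n q c).val := by
  rw [bOutV, Function.comp_apply, fanoutFn_apply, Function.comp_apply, fanoutFn_apply, bvalV_apply hm hj hidx,
    ipSumV_apply hm hj hidx]
  simp only [addFn_boolPair, bitsToNat_encodeNat, remFn_boolPair, Function.comp_apply, rootV, fstF_vOf, bqZ_zOf]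
  rw [← ZMod.val_natCast]
  refine congrArg encodeNat (congrArg ZMod.val ?_)
  simp only [Nat.cast_add, Nat.cast_sum, Nat.cast_mul, ZMod.natCast_zmod_val, dotProduct]

/-- **Value of `sampleOutV`**: the code of the shifted sample. [cite: Regev2009, §4 Lemma 4.1 (proof)] -/
theorem sampleOutV_apply (hm : 0 < m) (hj : j < K0 n) (hidx : idx < m) :
    sampleOutV (vOf S j c idx) = lweSampleCode (queryOf S ⟨j, hj⟩ c ⟨idx, hidx⟩) := by
  rw [sampleOutV, fanoutFn_apply, Function.comp_apply, fstF_sampleV_apply hm hj hidx, bOutV_apply hm hj hidx, queryOf,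
    shiftSample_apply]
  rfl

/-- Value of `sampleFrameP` (raw slot index). [folklore] -/
theorem sampleFrameP_apply (hm : 0 < m) (hj : j < K0 n) (hidx : idx < m) :
    sampleFrameP (boolPair (zOf S j c) (ones idx)) = boolPair (lweSampleCode (queryOf S ⟨j, hj⟩ c ⟨idx, hidx⟩)) [] := by
  rw [sampleFrameP, fanoutFn_apply, ← vOf_eq, sampleOutV_apply hm hj hidx]

/-- **Value of `qBlockZ`**: the block code of the query (coins of length `≥ n |bin q|`, which
dominates the length of a sample code). [cite: Regev2009, §4 Lemma 4.1 (proof)] -/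
theorem qBlockZ_apply (hm : 0 < m) (hj : j < K0 n) (hc : n * (encodeNat q).length ≤ c.length) :
    qBlockZ (zOf S j c) = lweBlockCode (queryOf S ⟨j, hj⟩ c) := by
  obtain ⟨hnz, hqz, -, hmz, -, hcz⟩ := bounds_zOf S j c hm
  have hmX : m ≤ (X : Polynomial ℕ).eval (zOf S j c).length := by rwa [eval_X]
  rw [qBlockZ, Function.comp_apply, Function.comp_apply, loopRec_apply, bmZ_zOf, foldLoop_apply _ _ hmX, sndPow_succ_boolPair,
    sndPow_succ_boolPair, sndPow_zero, sndF_boolPair, foldAcc_clipF, foldAcc_appF, List.nil_append, lweBlockCode,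
    ← frames_eq_encList, frames_ofFn_eq_ccat']
  · refine ccat_congr fun i hi => ?_
    rw [zero_add, sampleFrameP_apply hm hj hi, dif_pos hi]
  · intro i _ hi
    rw [zero_add] at hi
    rw [sampleFrameP_apply hm hj hi, length_boolPair, List.length_nil]
    have h1 := length_lweSampleCode_le (queryOf S ⟨j, hj⟩ c ⟨i, hi⟩)
    rw [sampleCodeBound] at h1
    nlinarith

/-- **The query generator meets its specification**: on the root input of attempt `j` it returns the
code of batch `j` shifted by the vector read off the coins. [cite: Regev2009, §4 Lemma 4.1 (proof)] -/
theorem queryZ_zOf (hm : 0 < m) (hj : j < K0 n) (hc : n * (encodeNat q).length ≤ c.length) :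
    queryZ (zOf S j c) = encodeLWESamples (queryOf S ⟨j, hj⟩ c) := by
  rw [queryZ, fanoutFn_apply, fanoutFn_apply, fanoutFn_apply, qBlockZ_apply hm hj hc, encodeLWESamples_eq, bnZ_zOf, bqZ_zOf,
    onesMZ_zOf S j c hm]

end Values

end AmpBricks

end LWE

end Literature.Computability.Cryptography
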